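import Literature.MathematicalPhysics.QuantumFieldTheory.Balaban1983to89.B9Thm37GlueTorusCovLevels
import Literature.MathematicalPhysics.QuantumFieldTheory.Balaban1983to89.B9Thm37GlueTorusCovPoinc

/-!
# `Balaban1983to89.B9Thm37GlueTorusCovLevelsPoinc` — a COERCIVITY CONSTANT for the level sum of (3.16):
# σ·‖f‖² ≤ ⟨f, (Δ_U + Σ_j a_j·G_jᵀG_j)f⟩ on every field whose support is covered by finitely many POINCARÉ
# LEVELS, σ explicit and uniform in the transport and in the volume; ℓ² bounds σ⁻¹ for the inverse and for the
# Dirichlet inverse G′ on Ω₀ (MODEL; own lineage pv21; imports `B9Thm37GlueTorusCovLevels` and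
# `B9Thm37GlueTorusCovPoinc` only; modifies nothing)

References (bib keys; the tags below cite only these):
* [B9] = `Balaban1985BackgroundPropagators` — T. Bałaban, *Propagators for lattice gauge theories in a background
  field*, Commun. Math. Phys. 99 (1985) 389–434.
* [B7] = `Balaban1985Averaging` — T. Bałaban, *Averaging operations for lattice gauge theories*, Commun. Math. Phys.
  98 (1985) 17–51 (= reference [5] of [B9]; only NAMED, through `B9Thm37GlueTorusCovComp`).

THE PRINTED LOCI.  NO new «» span in this file; everything printed is only NAMED and is certified in the headers of
modules in the import closure: [B9] (3.16) p. 393 (the quadratic form ⟨A, Q\*aQA⟩ = Σ_{j=0}^{k} a Σ_{b∈Λ_j}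
(L^jη)^{d−2}|(Q_j(U)A)(b)|², `B9Thm37GlueTorusCovLevels`), (3.15)/(3.18)–(3.19) p. 393 (the averaging operators,
`B9Thm37GlueTorusCov`, `B9Thm37GlueTorusCovComp`), (3.3) pp. 390–391 (∇_U, `B9Thm37Glue`), (3.23)–(3.24) p. 394
(Δ′_a = Δ_U + Q′\*aQ′, `B9Thm37Glue`, `B9Thm37GlueTorusCov`), p. 394 (Ω₀Δ′_aΩ₀ and its inverse G′,
`B9Thm37GlueTorusInv`), p. 395 *"Assuming some regularity of the configuration U it can be easily shown that the
operator Δ′_a is positive. This implies positivity of the operators G′ …"* (`B9Thm37Glue`).  NOTHING printed is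
asserted as a theorem — every declaration below is a MODEL definition or a kernel-checked theorem about the
component model of the lineage (`B9Thm37Glue.covD`, `B9Thm37GlueTorusCov.Comb`, `B9Thm37GlueTorusCovComp.gMean`,
`B9Thm37GlueTorusCovLevels.levelOp`, `B9Thm37GlueTorusInv.dirInv`).

THE POINT (value = a MODEL kernel certificate steering the lineage; NOT summit progress).
`B9Thm37GlueTorusCovLevels` proved the level operator `levelOp = Δ_U + Σ_j a_j·G_jᵀG_j` STRICTLY positive on fields
whose support is covered by the regions, and its Dirichlet compression to Ω₀ invertible on Ω₀ — and recorded in its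
honest scope (iv) "qualitative positivity and invertibility only: no coercivity constant, … no uniformity in U
beyond isometric".  `B9Thm37GlueTorusCovPoinc` has a constant, but only for ONE comb level whose block weights are
bounded below EVERYWHERE (|w(β)| ≥ w_min for all β), i.e. no regions and no Dirichlet data.  THIS FILE proves the
constant for the level sum, with BLOCK weights W_j = w_j ∘ blk_j (the shape of print's L^{−jd}·𝟙_{B^j(Λ_j)}; the
comb means of the chain have this shape, `B9Thm37GlueTorusCovComp.covMean_eq_gMean`), under a COVERING hypothesis
on the support of the field only:
 * §1 ONE BLOCK OF ONE LEVEL.  The deviation `gdev blk T base f x i` = (T(x)f(x))_i − f(base(blk x), i) of the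
   transported field from its value at the representative site of its block; the row isometry
   `sum_sq_orth_apply`; the mean with block weights is w(β)·(block sum of the transported field)
   (`gMean_blk_apply`); and the BLOCK POINCARÉ STEP `block_norm_sq_le`: for an isometric T and |w(β)| ≥ w_min > 0,
       Σ_{x∈β} Σ_i f(x,i)² ≤ w_min⁻²·Σ_i (G f)(β,i)² + Σ_{x∈β} Σ_i gdev(x,i)²
   (the block identity `B9Thm37GlueTorusCovPoinc.sum_sq_le_sq_sum_div_add` with v = f(base β, i)).
 * §2 THE COMB DEVIATION BOUND `sum_dev_sq_le` (re-assembled from `B9Thm37GlueTorusCovPoinc.dev_sq_le` and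
   `pathSum_le_blockSum`): for a comb K with isometric bond matrices, |c(b)| ≥ c_min > 0, depth ≤ D and blocks of
   at most n sites, Σ_x Σ_i dev(x,i)² ≤ D·n·c_min⁻²·Σ_b ((∇_U f)(b))² — a "Poincaré constant" P = D·n/c_min² for
   the comb level, for EVERY transport.
 * §3 FINITE-DIMENSIONAL FOLKLORE from a coercivity inequality σ‖f‖² ≤ ⟨f, Af⟩ (σ > 0): the ℓ² bound
   ‖A⁻¹g‖ ≤ σ⁻¹‖g‖ (`inverse_sq_le_of_coercive`), and — when coercivity is only known on fields supported in
   Ω₀ = {χ = 1} and ⟨f, Af⟩ ≥ 0 everywhere — positivity of A + (1 − Ω₀) (`posDef_add_compl_of_coercive`) and the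
   ℓ² bound ‖G′g‖ ≤ σ⁻¹‖g‖ for the Dirichlet inverse G′ = `dirInv A χ` of `B9Thm37GlueTorusInv`
   (`dirInv_sq_le_of_coercive`: G′ lives on Ω₀, Ω₀AΩ₀G′ = Ω₀, so ⟨G′g, AG′g⟩ = ⟨G′g, g⟩ ≤ ‖G′g‖‖g‖).
 * §4 THE LEVEL SUM.  **`norm_sq_le_levels`**: for a finite set S of "Poincaré levels" j with isometric transports
   and deviation bounds Σ_xΣ_i gdev_j² ≤ P_j·Σ_b (∇_U f)(b)², coefficients a_j ≥ 0, and a field f every site x of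
   whose support lies, for SOME j ∈ S with a_j ≥ a_min > 0, in a block with |w_j(blk_j x)| ≥ w_min > 0:
       Σ_p f(p)² ≤ (a_min w_min²)⁻¹·Σ_j a_j Σ_q (G_j f)(q)² + (Σ_{j∈S} P_j)·Σ_b ((∇_U f)(b))²
   (sum the block step over the covered pairs (j, β); overcounting only adds squares); hence
   **`coercive_levelOp`**: σ·Σ_p f(p)² ≤ Σ_p f(p)((Δ_U + Σ_j a_j G_jᵀG_j)f)(p) with
       σ = `sigmaL a_min w_min (Σ_{j∈S} P_j)` = ((a_min w_min²)⁻¹ + Σ_{j∈S} P_j)⁻¹ > 0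
   — the SAME σ for every bond transport Rm and every volume; positivity on covered supports WITHOUT the
   reproduction hypothesis `hrep` of `B9Thm37GlueTorusCovLevels` (the deviation bound is its quantitative form:
   `posDef_levelOp_of_dev`, `isUnit_levelOp_of_dev`); the ℓ² bound σ⁻¹ of `Ring.inverse levelOp` under a full cover
   (`inverse_sq_le_levelOp`) and of the DIRICHLET INVERSE `dirInv levelOp χ` when only Ω₀ = {χ = 1} is covered
   (`levelDir_sq_le`) — the uniformity in U and in the volume that honest scope (iv) of
   `B9Thm37GlueTorusCovLevels` recorded as not given.
 * §5 DISCHARGERS.  The identity level has deviation 0 (`gdev_lvl_zero`), the comb level of the three-level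
   family of `B9Thm37GlueTorusCovLevels` has the comb deviation `dev` (`gdev_lvl_one`), so with the level
   constants `lvlP` = (0, D·n/c_min², ·) and S = {0, 1}: **`coercive_threeLevelOp`**,
   `inverse_sq_le_threeLevelOp`, `threeLevelDir_sq_le` with σ = `B9Thm37GlueTorusCovPoinc.sigma a_min w_min c_min
   D n` — the composite level 2 may be present with any a₂ ≥ 0 but is NOT a Poincaré level here (no deviation
   bound for composite means is claimed).  The ONE comb level (J = Unit) gives back the operator of
   `B9Thm37GlueTorusCov` (`levelOp_comb_eq`) and so generalises `B9Thm37GlueTorusCovPoinc.coercive_covLapCov` to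
   weights bounded below only on the blocks meeting the support (`coercive_covLapCov_of_cover`) and to Dirichlet
   data (`dirInv_covLapCov_sq_le`).
 * §6 THE TORUS `UT N` with the lexicographic cube combs (sides M₀ for levels 1 and the one-comb operator, M for
   the composite level): depth ≤ d(M₀ − 1) and blocks of ≤ M₀^d sites (`B9Thm37GlueTorusCovPoinc.tdepth_le`,
   `card_block_le`), whence `coercive_threeLevelOp_torus`, `inverse_sq_le_threeLevelOp_torus`,
   `threeLevelDir_sq_le_torus`, `dirInv_covLapCov_sq_le_torus` with σ = `sigmaTorus d M₀ a_min w_min c_min` —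
   independent of N (the volume), of M (the coarse side) and of the transport.

NOT ASSERTED, NOT MODELLED (honest scope).  (i) As in the two imported modules: the averaged configurations Ū^i of
[B7] are NOT constructed; coarse transports are comb holonomies of U itself or free data; no regularity of U is
used or concluded.  (ii) The constant is the crude comb constant D·n/c_min² = d(M₀−1)M₀^d/c_min² of
`B9Thm37GlueTorusCovPoinc`, not the O((L^jη)²) of a genuine cube Poincaré inequality, and only levels whose
deviation is controlled along ONE comb (identity, one-step comb) are Poincaré levels — composite (j ≥ 2) levels
enter the operator with a_j ≥ 0 but contribute nothing to σ; print's scale factors (L^jη)^{d−2}, L^{−jd} are not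
tracked.  (iii) ℓ² bounds only: no decay of the inverses, nothing of (3.17), Theorems 3.1–3.3, Corollary 3.6,
Theorem 3.7 or (1.31)/Proposition 1.1 of [B9]; the capstones of the chain are not re-wired here.  (iv) Component
site fields `St × Cp → ℝ`, not algebra-valued bond fields.  Value = MODEL kernel certificate, NOT summit progress;
NOT continuum, NOT Clay, NOT a claim about print.
-/

namespace Literature.MathematicalPhysics.QuantumFieldTheory.Balaban1983to89.B9Thm37GlueTorusCovLevelsPoinc

open Finset B9Thm37Sum B9Thm37Glue B9Thm37GlueTorusInv B9Thm37GlueTorusCov B9Thm37GlueTorusCovComp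
  B9Thm37GlueTorusCovPoinc B9Thm37GlueTorusCovLevels
open B5TorusCover (UT Ctr ctrU)

noncomputable section

/-! ## §1  One block of one level: the deviation and the block Poincaré step with block weights -/

section BlockStep

variable {St B Cp : Type} [Fintype Cp] [DecidableEq Cp]

/-- MODEL bookkeeping: **the deviation of a level** — (T(x)f(x))_i − f(base(blk x), i), the transported field at x
minus the field at the representative site of the block of x (for the comb level this is
`B9Thm37GlueTorusCovPoinc.dev`, `gdev_comb`/`gdev_lvl_one`; for the identity level it is 0, `gdev_lvl_zero`).
[folklore] -/
def gdev (blk : St → B) (T : St → Cp → Cp → ℝ) (base : B → St) (f : St × Cp → ℝ) (x : St) (i : Cp) : ℝ :=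
  (∑ k, T x i k * f (x, k)) - f (base (blk x), i)

/-- **Row isometry**: Σ_i (Σ_k P_{ik} v_k)² = Σ_k v_k² for a matrix with orthonormal columns
(Σ_k P_{ki}P_{ki′} = δ_{ii′}; in finite dimension rows are then orthonormal too). [folklore] -/
theorem sum_sq_orth_apply {P : Cp → Cp → ℝ} (hP : ∀ i i', ∑ k, P k i * P k i' = if i = i' then (1 : ℝ) else 0)
    (v : Cp → ℝ) : ∑ i, (∑ k, P i k * v k) ^ 2 = ∑ k, v k ^ 2 := by
  calc ∑ i, (∑ k, P i k * v k) ^ 2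
      = ∑ i, ∑ k, ∑ l, P i k * v k * (P i l * v l) := by
        refine Finset.sum_congr rfl fun i _ => ?_
        rw [sq, Finset.sum_mul_sum]
    _ = ∑ k, ∑ l, v k * v l * ∑ i, P i k * P i l := by
        rw [Finset.sum_comm]
        refine Finset.sum_congr rfl fun k _ => ?_
        rw [Finset.sum_comm]
        refine Finset.sum_congr rfl fun l _ => ?_
        rw [Finset.mul_sum]
        exact Finset.sum_congr rfl fun i _ => by ring
    _ = ∑ k, ∑ l, v k * v l * (if k = l then (1 : ℝ) else 0) := by
        refine Finset.sum_congr rfl fun k _ => Finset.sum_congr rfl fun l _ => ?_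
        rw [hP k l]
    _ = ∑ k, v k ^ 2 := by
        refine Finset.sum_congr rfl fun k _ => ?_
        rw [Finset.sum_eq_single k (fun l _ hl => by rw [if_neg (Ne.symm hl), mul_zero])
          (fun h => absurd (mem_univ k) h)]
        simp [sq]

variable [Fintype St] [DecidableEq B]

omit [DecidableEq Cp] in
/-- **A covariant mean with BLOCK weights** W = w ∘ blk is the block weight times the block sum of the
transported field: (G f)(β, i) = w(β)·Σ_{x : blk x = β} (T(x)f(x))_i. [cite: Balaban1985BackgroundPropagators, (3.19) p.393] -/
theorem gMean_blk_apply (blk : St → B) (w : B → ℝ) (T : St → Cp → Cp → ℝ) (f : St × Cp → ℝ) (β : B) (i : Cp) :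
    gMean blk (fun x => w (blk x)) T f (β, i) =
      w β * ∑ x ∈ univ.filter (fun x => blk x = β), ∑ k, T x i k * f (x, k) := by
  rw [gMean_apply, Finset.sum_filter, Finset.mul_sum]
  refine Finset.sum_congr rfl fun x _ => ?_
  dsimp only
  split_ifs with h
  · rw [h]
  · rw [mul_zero]

omit [DecidableEq Cp] in
/-- **The block Poincaré step, one component**: for |w(β)| ≥ w_min > 0 and every base map,
Σ_{x∈β} (T(x)f(x))_i² ≤ w_min⁻²·(G f)(β, i)² + Σ_{x∈β} gdev(x, i)² (the block identity
`sum_sq_le_sq_sum_div_add` with v = f(base β, i), and |β| ≥ 1). [folklore] -/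
theorem block_sq_le (blk : St → B) (w : B → ℝ) (T : St → Cp → Cp → ℝ) (base : B → St) (f : St × Cp → ℝ)
    (β : B) (i : Cp) {wmin : ℝ} (hwmin : 0 < wmin) (hw : wmin ≤ |w β|) :
    ∑ x ∈ univ.filter (fun x => blk x = β), (∑ k, T x i k * f (x, k)) ^ 2 ≤
      (wmin ^ 2)⁻¹ * gMean blk (fun x => w (blk x)) T f (β, i) ^ 2 +
        ∑ x ∈ univ.filter (fun x => blk x = β), gdev blk T base f x i ^ 2 := by
  set s := univ.filter (fun x => blk x = β) with hs_def
  set h : St → ℝ := fun x => ∑ k, T x i k * f (x, k) with hh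
  have hw0 : w β ≠ 0 := fun h0 => by rw [h0, abs_zero] at hw; linarith
  rcases s.eq_empty_or_nonempty with hs | hs
  · rw [hs]
    simp only [Finset.sum_empty, add_zero]
    exact mul_nonneg (inv_nonneg.mpr (sq_nonneg _)) (sq_nonneg _)
  · have h1 := sum_sq_le_sq_sum_div_add s hs h (f (base β, i))
    have h2 : ∑ x ∈ s, (h x - f (base β, i)) ^ 2 = ∑ x ∈ s, gdev blk T base f x i ^ 2 := by
      refine Finset.sum_congr rfl fun x hx => ?_
      rw [hs_def, mem_filter] at hx
      unfold gdev
      rw [hx.2]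
    have h3 : (∑ x ∈ s, h x) ^ 2 / s.card ≤ (wmin ^ 2)⁻¹ * gMean blk (fun x => w (blk x)) T f (β, i) ^ 2 := by
      have hS : ∑ x ∈ s, h x = (w β)⁻¹ * gMean blk (fun x => w (blk x)) T f (β, i) := by
        rw [gMean_blk_apply, ← mul_assoc, inv_mul_cancel₀ hw0, one_mul]
      rw [hS, mul_pow, div_eq_mul_inv]
      have hcard : (1 : ℝ) ≤ s.card := by exact_mod_cast hs.card_pos
      have hwb : (w β)⁻¹ ^ 2 ≤ (wmin ^ 2)⁻¹ := by
        rw [inv_pow]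
        exact inv_anti₀ (pow_pos hwmin 2) ((pow_le_pow_left₀ hwmin.le hw 2).trans_eq (sq_abs _))
      calc (w β)⁻¹ ^ 2 * gMean blk (fun x => w (blk x)) T f (β, i) ^ 2 * (s.card : ℝ)⁻¹
          ≤ (w β)⁻¹ ^ 2 * gMean blk (fun x => w (blk x)) T f (β, i) ^ 2 * 1 :=
            mul_le_mul_of_nonneg_left (inv_le_one_of_one_le₀ hcard) (mul_nonneg (sq_nonneg _) (sq_nonneg _))
        _ ≤ (wmin ^ 2)⁻¹ * gMean blk (fun x => w (blk x)) T f (β, i) ^ 2 := by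
            rw [mul_one]
            exact mul_le_mul_of_nonneg_right hwb (sq_nonneg _)
    linarith

/-- **THE BLOCK POINCARÉ STEP** (all components; T an isometry at every site): for |w(β)| ≥ w_min > 0,
Σ_{x∈β} Σ_i f(x, i)² ≤ w_min⁻²·Σ_i (G f)(β, i)² + Σ_{x∈β} Σ_i gdev(x, i)². [folklore] -/
theorem block_norm_sq_le (blk : St → B) (w : B → ℝ) {T : St → Cp → Cp → ℝ}
    (hT : ∀ x i i', ∑ k, T x k i * T x k i' = if i = i' then (1 : ℝ) else 0) (base : B → St)
    (f : St × Cp → ℝ) (β : B) {wmin : ℝ} (hwmin : 0 < wmin) (hw : wmin ≤ |w β|) :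
    ∑ x ∈ univ.filter (fun x => blk x = β), ∑ i, f (x, i) ^ 2 ≤
      (wmin ^ 2)⁻¹ * ∑ i, gMean blk (fun x => w (blk x)) T f (β, i) ^ 2 +
        ∑ x ∈ univ.filter (fun x => blk x = β), ∑ i, gdev blk T base f x i ^ 2 := by
  have hiso : ∀ x, ∑ i, f (x, i) ^ 2 = ∑ i, (∑ k, T x i k * f (x, k)) ^ 2 := fun x =>
    (sum_sq_orth_apply (hT x) fun k => f (x, k)).symm
  calc ∑ x ∈ univ.filter (fun x => blk x = β), ∑ i, f (x, i) ^ 2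
      = ∑ i, ∑ x ∈ univ.filter (fun x => blk x = β), (∑ k, T x i k * f (x, k)) ^ 2 := by
        rw [Finset.sum_congr rfl fun x _ => hiso x, Finset.sum_comm]
    _ ≤ ∑ i, ((wmin ^ 2)⁻¹ * gMean blk (fun x => w (blk x)) T f (β, i) ^ 2 +
          ∑ x ∈ univ.filter (fun x => blk x = β), gdev blk T base f x i ^ 2) :=
        Finset.sum_le_sum fun i _ => block_sq_le blk w T base f β i hwmin hw
    _ = (wmin ^ 2)⁻¹ * ∑ i, gMean blk (fun x => w (blk x)) T f (β, i) ^ 2 +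
          ∑ x ∈ univ.filter (fun x => blk x = β), ∑ i, gdev blk T base f x i ^ 2 := by
        rw [Finset.sum_add_distrib, ← Finset.mul_sum]
        congr 1
        exact Finset.sum_comm

end BlockStep

/-! ## §2  The comb deviation bound: Σ_x Σ_i dev(x, i)² ≤ D·n·c_min⁻²·Σ_b ((∇_U f)(b))² -/

section CombDeviation

variable {St Bd B Cp : Type} [Fintype St] [DecidableEq St] [Fintype Bd] [Fintype B] [DecidableEq B] [Fintype Cp]
  [DecidableEq Cp] {src tgt : Bd → St} (K : Comb src tgt B) (c : Bd → ℝ) (Rm : Bd → Cp → Cp → ℝ)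

omit [Fintype St] [DecidableEq St] [Fintype Bd] [Fintype B] [DecidableEq B] in
/-- The comb deviation of `B9Thm37GlueTorusCovPoinc` is the level deviation of the comb level (blocks labelled in
B, base = K.base, T = the comb holonomy). [folklore] -/
theorem gdev_comb (f : St × Cp → ℝ) (x : St) (i : Cp) : gdev K.blk (K.tr Rm) K.base f x i = dev K Rm f x i := rfl

/-- **THE COMB DEVIATION BOUND (total).** For isometric bond matrices (hRm), bond weights |c(b)| ≥ c_min > 0, comb
depth ≤ D and blocks of at most n sites: Σ_x Σ_i dev(x, i)² ≤ D·n·c_min⁻²·Σ_b ((∇_U f)(b))² for EVERY field f —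
uniform in the transport (pointwise `dev_sq_le`, the path sum bounded by the block sum `pathSum_le_blockSum`, each
block sum counted at most n times, the parent-bond map injective). [folklore] -/
theorem sum_dev_sq_le (hRm : ∀ b i j, ∑ k, Rm b k i * Rm b k j = if i = j then (1 : ℝ) else 0)
    {cmin : ℝ} (hcmin : 0 < cmin) (hc : ∀ b, cmin ≤ |c b|) {D : ℕ} (hD : ∀ x, K.depth x ≤ D) {n : ℕ}
    (hn : ∀ β, (univ.filter fun x => K.blk x = β).card ≤ n) (f : St × Cp → ℝ) :
    ∑ x, ∑ i, dev K Rm f x i ^ 2 ≤ (D : ℝ) * n * (cmin ^ 2)⁻¹ * ∑ b, covD src tgt c Rm f b ^ 2 := by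
  classical
  have hc0 : ∀ b, c b ≠ 0 := fun b h0 => by have := hc b; rw [h0, abs_zero] at this; linarith
  set u : Bd → ℝ := fun b => (c b)⁻¹ ^ 2 * ∑ k, covD src tgt c Rm f (b, k) ^ 2 with hu_def
  set g : Bd → ℝ := fun b => ∑ k, covD src tgt c Rm f (b, k) ^ 2 with hg
  have hg0 : ∀ b, 0 ≤ g b := fun b => Finset.sum_nonneg fun k _ => sq_nonneg _
  have hu0 : ∀ b, 0 ≤ u b := fun b => mul_nonneg (sq_nonneg _) (hg0 b)
  have hug : ∀ b, u b ≤ (cmin ^ 2)⁻¹ * g b := by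
    intro b
    refine mul_le_mul_of_nonneg_right ?_ (hg0 b)
    rw [inv_pow]
    exact inv_anti₀ (pow_pos hcmin 2) (pow_le_pow_left₀ hcmin.le ((hc b).trans (le_abs_self _ |>.trans_eq
      (abs_abs _))) 2 |>.trans_eq (sq_abs _))
  -- per site: Σ_i dev² ≤ D · (cmin²)⁻¹ · Σ_{y in block, depth ≠ 0} g (pbond y)
  have hdev : ∀ x, ∑ i, dev K Rm f x i ^ 2 ≤
      (D : ℝ) * ((cmin ^ 2)⁻¹ * ∑ y ∈ univ.filter (fun y => K.blk y = K.blk x ∧ K.depth y ≠ 0), g (K.pbond y)) := by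
    intro x
    refine (dev_sq_le K c Rm hRm hc0 f x).trans ?_
    refine mul_le_mul (by exact_mod_cast hD x) ?_ (pathSum_nonneg K hu0 x) (Nat.cast_nonneg _)
    refine (pathSum_mono K hug x).trans ?_
    refine (pathSum_le_blockSum K (fun b => mul_nonneg (inv_nonneg.mpr (sq_nonneg _)) (hg0 b)) x).trans_eq ?_
    rw [← Finset.mul_sum]
  -- block sums, each counted at most n times
  set T : B → ℝ := fun β => ∑ y ∈ univ.filter (fun y => K.blk y = β ∧ K.depth y ≠ 0), g (K.pbond y) with hT
  have hT0 : ∀ β, 0 ≤ T β := fun β => Finset.sum_nonneg fun y _ => hg0 _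
  have hTsum : ∑ x, T (K.blk x) = ∑ β, ((univ.filter fun x => K.blk x = β).card : ℝ) * T β := by
    rw [← Finset.sum_fiberwise_of_maps_to (s := univ) (t := univ) (g := K.blk) (fun x _ => mem_univ _)]
    refine Finset.sum_congr rfl fun β _ => ?_
    rw [Finset.sum_congr rfl fun x hx => show T (K.blk x) = T β by rw [(mem_filter.mp hx).2],
      Finset.sum_const, nsmul_eq_mul]
  have hTle : ∑ β, ((univ.filter fun x => K.blk x = β).card : ℝ) * T β ≤ n * ∑ β, T β := by
    rw [Finset.mul_sum]
    exact Finset.sum_le_sum fun β _ => mul_le_mul_of_nonneg_right (by exact_mod_cast hn β) (hT0 β)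
  -- Σ_β T β = Σ_{y : depth y ≠ 0} g (pbond y) ≤ Σ_b g b   (pbond injective on positive depth: tgt ∘ pbond = id)
  have hTtot : ∑ β, T β = ∑ y ∈ univ.filter (fun y => K.depth y ≠ 0), g (K.pbond y) := by
    rw [hT]
    rw [← Finset.sum_fiberwise_of_maps_to (s := univ.filter fun y => K.depth y ≠ 0) (t := univ) (g := K.blk)
      (fun y _ => mem_univ _)]
    refine Finset.sum_congr rfl fun β _ => Finset.sum_congr ?_ fun _ _ => rfl
    ext y
    simp only [mem_filter, mem_univ, true_and]
    tauto
  have hinj : Set.InjOn K.pbond ↑(univ.filter fun y : St => K.depth y ≠ 0) := by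
    intro y hy y' hy' hyy
    have h1 := K.tgt_pbond y (mem_filter.mp hy).2
    have h2 := K.tgt_pbond y' (mem_filter.mp hy').2
    rw [← h1, ← h2, hyy]
  have hpb : ∑ y ∈ univ.filter (fun y => K.depth y ≠ 0), g (K.pbond y) ≤ ∑ b, g b := by
    rw [← Finset.sum_image hinj]
    exact sum_le_sum_of_subset_of_nonneg (fun b _ => mem_univ b) fun b _ _ => hg0 b
  have hG : ∑ b, g b = ∑ b, covD src tgt c Rm f b ^ 2 := by
    rw [Fintype.sum_prod_type]
  calc ∑ x, ∑ i, dev K Rm f x i ^ 2 ≤ ∑ x, (D : ℝ) * ((cmin ^ 2)⁻¹ * T (K.blk x)) :=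
        Finset.sum_le_sum fun x _ => hdev x
    _ = (D : ℝ) * (cmin ^ 2)⁻¹ * ∑ x, T (K.blk x) := by
        rw [Finset.mul_sum]
        exact Finset.sum_congr rfl fun x _ => by ring
    _ ≤ (D : ℝ) * (cmin ^ 2)⁻¹ * (n * ∑ b, g b) := by
        have hDc : (0 : ℝ) ≤ (D : ℝ) * (cmin ^ 2)⁻¹ :=
          mul_nonneg (Nat.cast_nonneg D) (inv_nonneg.mpr (sq_nonneg cmin))
        refine mul_le_mul_of_nonneg_left ?_ hDc
        rw [hTsum]
        exact hTle.trans (mul_le_mul_of_nonneg_left (hTtot.trans_le hpb) (Nat.cast_nonneg _))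
    _ = (D : ℝ) * n * (cmin ^ 2)⁻¹ * ∑ b, covD src tgt c Rm f b ^ 2 := by
        rw [hG]
        ring

end CombDeviation

/-! ## §3  Folklore: what a coercivity inequality gives — ℓ² bounds of the inverse and of the Dirichlet inverse -/

section Coercive

variable {X : Type} [Fintype X]

/-- Cauchy–Schwarz bookkeeping: σ‖u‖² ≤ ⟨u, g⟩ with σ > 0 ⟹ ‖u‖² ≤ σ⁻²‖g‖². [folklore] -/
theorem sq_sum_le_of_inner {σ : ℝ} (hσ : 0 < σ) {u g : X → ℝ} (h : σ * ∑ x, u x ^ 2 ≤ ∑ x, u x * g x) :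
    ∑ x, u x ^ 2 ≤ (σ ^ 2)⁻¹ * ∑ x, g x ^ 2 := by
  have hcs := Finset.sum_mul_sq_le_sq_mul_sq univ u g
  set U2 := ∑ x, u x ^ 2 with hU2
  set G2 := ∑ x, g x ^ 2 with hG2
  have hU0 : 0 ≤ U2 := Finset.sum_nonneg fun p _ => sq_nonneg _
  have hG0 : 0 ≤ G2 := Finset.sum_nonneg fun p _ => sq_nonneg _
  have h2 : (σ * U2) ^ 2 ≤ U2 * G2 := (pow_le_pow_left₀ (mul_nonneg hσ.le hU0) h 2).trans hcs
  have h3 : σ ^ 2 * U2 ≤ G2 := by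
    rcases hU0.eq_or_lt with h0 | hpos
    · rw [← h0, mul_zero]; exact hG0
    · have : σ ^ 2 * U2 * U2 ≤ G2 * U2 := by nlinarith
      exact le_of_mul_le_mul_right this hpos
  calc U2 = (σ ^ 2)⁻¹ * (σ ^ 2 * U2) := by rw [← mul_assoc, inv_mul_cancel₀ (pow_pos hσ 2).ne', one_mul]
    _ ≤ (σ ^ 2)⁻¹ * G2 := mul_le_mul_of_nonneg_left h3 (inv_nonneg.mpr (sq_nonneg _))

/-- A coercive operator (σ‖f‖² ≤ ⟨f, Af⟩ for all f, σ > 0) is strictly positive. [folklore] -/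
theorem posDef_of_coercive (A : Module.End ℝ (X → ℝ)) {σ : ℝ} (hσ : 0 < σ)
    (hco : ∀ f : X → ℝ, σ * ∑ x, f x ^ 2 ≤ ∑ x, f x * A f x) (f : X → ℝ) (hf : f ≠ 0) :
    0 < ∑ x, f x * A f x := by
  obtain ⟨x₀, hx₀⟩ := Function.ne_iff.mp hf
  have hpos : 0 < ∑ x, f x ^ 2 := lt_of_lt_of_le (by rw [sq]; exact mul_self_pos.mpr hx₀)
    (Finset.single_le_sum (f := fun x => f x ^ 2) (fun x _ => sq_nonneg (f x)) (mem_univ x₀))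
  exact lt_of_lt_of_le (mul_pos hσ hpos) (hco f)

/-- **ℓ² bound of the inverse of a coercive operator**: Σ_x (A⁻¹g)(x)² ≤ σ⁻²·Σ_x g(x)² (A⁻¹ = `Ring.inverse A`, a
genuine two-sided inverse by positivity). [folklore] -/
theorem inverse_sq_le_of_coercive (A : Module.End ℝ (X → ℝ)) {σ : ℝ} (hσ : 0 < σ)
    (hco : ∀ f : X → ℝ, σ * ∑ x, f x ^ 2 ≤ ∑ x, f x * A f x) (g : X → ℝ) :
    ∑ x, (Ring.inverse A g) x ^ 2 ≤ (σ ^ 2)⁻¹ * ∑ x, g x ^ 2 := by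
  have hAu : A (Ring.inverse A g) = g := by
    have h := mul_inverse_of_posDef (posDef_of_coercive A hσ hco)
    have := congrArg (fun T : Module.End ℝ (X → ℝ) => T g) h
    simpa [Module.End.mul_apply] using this
  have h := hco (Ring.inverse A g)
  rw [hAu] at h
  exact sq_sum_le_of_inner hσ h

/-- **Positivity of A + (1 − Ω₀) from coercivity on Ω₀-supported fields**: χ {0,1}-valued, ⟨f, Af⟩ ≥ 0 for all f,
and σ‖f‖² ≤ ⟨f, Af⟩ for every f supported in Ω₀ = {χ = 1} ⟹ Σ f·(A + M_{1−χ})f > 0 for f ≠ 0 (a field meeting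
{χ = 0} is seen by the added mass). [folklore] -/
theorem posDef_add_compl_of_coercive (A : Module.End ℝ (X → ℝ)) {χ : X → ℝ} (hχ : ∀ x, χ x = 0 ∨ χ x = 1)
    (hA0 : ∀ f : X → ℝ, 0 ≤ ∑ x, f x * A f x) {σ : ℝ} (hσ : 0 < σ)
    (hco : ∀ f : X → ℝ, (∀ x, f x ≠ 0 → χ x = 1) → σ * ∑ x, f x ^ 2 ≤ ∑ x, f x * A f x)
    (f : X → ℝ) (hf : f ≠ 0) : 0 < ∑ x, f x * (A + mulOp (1 - χ) : Module.End ℝ (X → ℝ)) f x := by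
  have hsplit : ∑ x, f x * (A + mulOp (1 - χ) : Module.End ℝ (X → ℝ)) f x =
      ∑ x, f x * A f x + ∑ x, (1 - χ) x * (f x * f x) := by
    rw [← Finset.sum_add_distrib]
    refine Finset.sum_congr rfl fun x _ => ?_
    rw [LinearMap.add_apply, Pi.add_apply, mulOp_apply]
    ring
  rw [hsplit]
  have h1 : ∀ x, 0 ≤ (1 - χ) x * (f x * f x) := fun x =>
    mul_nonneg (by rcases hχ x with h | h <;> simp only [Pi.sub_apply, Pi.one_apply, h, sub_zero, sub_self,
      zero_le_one, le_refl]) (mul_self_nonneg _)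
  by_cases hout : ∃ x, f x ≠ 0 ∧ χ x = 0
  · obtain ⟨x₀, hx₀, hχ₀⟩ := hout
    refine add_pos_of_nonneg_of_pos (hA0 f) ?_
    refine lt_of_lt_of_le ?_
      (Finset.single_le_sum (f := fun x => (1 - χ) x * (f x * f x)) (fun x _ => h1 x) (mem_univ x₀))
    have h10 : (1 - χ) x₀ = 1 := by rw [Pi.sub_apply, Pi.one_apply, hχ₀, sub_zero]
    rw [h10, one_mul]
    exact mul_self_pos.mpr hx₀
  · refine add_pos_of_pos_of_nonneg ?_ (Finset.sum_nonneg fun x _ => h1 x)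
    have hsupp : ∀ x, f x ≠ 0 → χ x = 1 := fun x hx => by
      rcases hχ x with h | h
      · exact absurd ⟨x, hx, h⟩ hout
      · exact h
    obtain ⟨x₀, hx₀⟩ := Function.ne_iff.mp hf
    have hpos : 0 < ∑ x, f x ^ 2 := lt_of_lt_of_le (by rw [sq]; exact mul_self_pos.mpr hx₀)
      (Finset.single_le_sum (f := fun x => f x ^ 2) (fun x _ => sq_nonneg (f x)) (mem_univ x₀))
    exact lt_of_lt_of_le (mul_pos hσ hpos) (hco f hsupp)

/-- **ℓ² BOUND OF THE DIRICHLET INVERSE from coercivity on Ω₀**: under the hypotheses of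
`posDef_add_compl_of_coercive`, G′ = `dirInv A χ` satisfies Σ_x (G′g)(x)² ≤ σ⁻²·Σ_x g(x)² for every g — G′ lives on
Ω₀ (`mulOp_mul_dirInv_mul_mulOp`) and Ω₀AΩ₀G′ = Ω₀ (`sandwichΩ_mul_dirInv`), so ⟨G′g, AG′g⟩ = ⟨G′g, g⟩ ≤ ‖G′g‖‖g‖.
[folklore] -/
theorem dirInv_sq_le_of_coercive (A : Module.End ℝ (X → ℝ)) {χ : X → ℝ} (hχ : ∀ x, χ x = 0 ∨ χ x = 1)
    (hA0 : ∀ f : X → ℝ, 0 ≤ ∑ x, f x * A f x) {σ : ℝ} (hσ : 0 < σ)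
    (hco : ∀ f : X → ℝ, (∀ x, f x ≠ 0 → χ x = 1) → σ * ∑ x, f x ^ 2 ≤ ∑ x, f x * A f x) (g : X → ℝ) :
    ∑ x, (dirInv A χ g) x ^ 2 ≤ (σ ^ 2)⁻¹ * ∑ x, g x ^ 2 := by
  have hpos := posDef_add_compl_of_coercive A hχ hA0 hσ hco
  -- Ω₀AΩ₀G′ = Ω₀ and Ω₀G′Ω₀ = G′
  have hR : mulOp χ * A * mulOp χ * dirInv A χ = mulOp χ := by
    have h := sandwichΩ_mul_dirInv hpos hχ
    rwa [sandwich_add_compl A hχ, dirInv_add_compl A hχ] at h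
  have hS : mulOp χ * dirInv A χ * mulOp χ = dirInv A χ := mulOp_mul_dirInv_mul_mulOp A hχ
  have hχ2 : ∀ x, χ x * χ x = χ x := fun x => by rcases hχ x with h | h <;> simp [h]
  -- u = G′g is supported in Ω₀
  have hmu : ∀ x, χ x * dirInv A χ g x = dirInv A χ g x := by
    intro x
    have v1 : dirInv A χ g x = χ x * (dirInv A χ (mulOp χ g)) x := by
      have := congrArg (fun T : Module.End ℝ (X → ℝ) => T g x) hS
      simp only [Module.End.mul_apply, mulOp_apply] at this
      exact this.symm
    rw [v1, ← mul_assoc, hχ2]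
  have hmu' : mulOp χ (dirInv A χ g) = dirInv A χ g := funext fun x => by rw [mulOp_apply]; exact hmu x
  -- Ω₀·A u = Ω₀·g
  have hAu : ∀ x, χ x * A (dirInv A χ g) x = χ x * g x := by
    intro x
    have := congrArg (fun T : Module.End ℝ (X → ℝ) => T g x) hR
    simp only [Module.End.mul_apply, mulOp_apply] at this
    rw [hmu'] at this
    exact this
  -- ⟨u, A u⟩ = ⟨u, g⟩
  have hinner : ∑ x, dirInv A χ g x * A (dirInv A χ g) x = ∑ x, dirInv A χ g x * g x := by
    refine Finset.sum_congr rfl fun x _ => ?_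
    calc dirInv A χ g x * A (dirInv A χ g) x = χ x * dirInv A χ g x * A (dirInv A χ g) x := by rw [hmu x]
      _ = dirInv A χ g x * (χ x * A (dirInv A χ g) x) := by ring
      _ = dirInv A χ g x * (χ x * g x) := by rw [hAu x]
      _ = χ x * dirInv A χ g x * g x := by ring
      _ = dirInv A χ g x * g x := by rw [hmu x]
  have hsupp : ∀ x, dirInv A χ g x ≠ 0 → χ x = 1 := by
    intro x hx
    rcases hχ x with h0 | h1
    · exact absurd (by rw [← hmu x, h0, zero_mul]) hx
    · exact h1
  have h := hco (dirInv A χ g) hsupp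
  rw [hinner] at h
  exact sq_sum_le_of_inner hσ h

end Coercive

/-! ## §4  The level sum: Σ_p f² ≤ (a_min w_min²)⁻¹·Σ_j a_j‖G_j f‖² + (Σ_{j∈S} P_j)·‖∇_U f‖² on covered supports -/

section Assembly

variable {St Bd B Cp J : Type} [Fintype St] [DecidableEq St] [Fintype Bd] [Fintype B] [DecidableEq B]
  [Fintype Cp] [DecidableEq Cp] [Fintype J]
  (src tgt : Bd → St) (c : Bd → ℝ) (Rm : Bd → Cp → Cp → ℝ)
  (blk : J → St → B) (w : J → B → ℝ) (T : J → St → Cp → Cp → ℝ) (base : J → B → St) (a : J → ℝ)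

omit [DecidableEq St] in
/-- **MAIN INEQUALITY (MODEL).** Levels j ∈ S have isometric transports (`hT`) and DEVIATION BOUNDS
Σ_xΣ_i gdev_j(x,i)² ≤ P_j·Σ_b ((∇_U f)(b))² (`hP`); all a_j ≥ 0; and every site x of the support of f lies, for some
j ∈ S with a_j ≥ a_min > 0, in a block with |w_j(blk_j x)| ≥ w_min > 0 (`hcov`).  Then
Σ_p f(p)² ≤ (a_min w_min²)⁻¹·Σ_j a_j Σ_q (G_j f)(q)² + (Σ_{j∈S} P_j)·Σ_b ((∇_U f)(b))², G_j the covariant mean with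
block weights w_j ∘ blk_j — for EVERY bond transport Rm. [folklore] -/
theorem norm_sq_le_levels (S : Finset J)
    (hT : ∀ j ∈ S, ∀ x i i', ∑ k, T j x k i * T j x k i' = if i = i' then (1 : ℝ) else 0)
    (ha : ∀ j, 0 ≤ a j) (P : J → ℝ) (f : St × Cp → ℝ)
    (hP : ∀ j ∈ S, ∑ x, ∑ i, gdev (blk j) (T j) (base j) f x i ^ 2 ≤ P j * ∑ b, covD src tgt c Rm f b ^ 2)
    {amin wmin : ℝ} (hamin : 0 < amin) (hwmin : 0 < wmin)
    (hcov : ∀ x i, f (x, i) ≠ 0 → ∃ j ∈ S, amin ≤ a j ∧ wmin ≤ |w j (blk j x)|) :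
    ∑ p, f p ^ 2 ≤
      (amin * wmin ^ 2)⁻¹ * ∑ j, a j * ∑ q, gMean (blk j) (fun x => w j (blk j x)) (T j) f q ^ 2 +
        (∑ j ∈ S, P j) * ∑ b, covD src tgt c Rm f b ^ 2 := by
  classical
  set Y := ∑ b, covD src tgt c Rm f b ^ 2 with hYdef
  have hY0 : 0 ≤ Y := Finset.sum_nonneg fun b _ => sq_nonneg _
  set X : J → ℝ := fun j => ∑ q, gMean (blk j) (fun x => w j (blk j x)) (T j) f q ^ 2 with hXdef
  have hX0 : ∀ j, 0 ≤ X j := fun j => Finset.sum_nonneg fun q _ => sq_nonneg _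
  set Dv : J → ℝ := fun j => ∑ x, ∑ i, gdev (blk j) (T j) (base j) f x i ^ 2 with hDvdef
  have hDv0 : ∀ j, 0 ≤ Dv j := fun j => Finset.sum_nonneg fun x _ => Finset.sum_nonneg fun i _ => sq_nonneg _
  have hPY : ∀ j ∈ S, 0 ≤ P j * Y := fun j hj => (hDv0 j).trans (hP j hj)
  set S' := S.filter (fun j => amin ≤ a j) with hS'def
  have hS'S : S' ⊆ S := Finset.filter_subset _ _
  set nf : St → ℝ := fun x => ∑ i, f (x, i) ^ 2 with hnfdef
  have hnf0 : ∀ x, 0 ≤ nf x := fun x => Finset.sum_nonneg fun i _ => sq_nonneg _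
  -- (1) the cover: ‖f‖² ≤ Σ_{j∈S'} Σ_x [the j-block of x is weighted] ‖f(x)‖²
  have h1 : ∑ p, f p ^ 2 ≤ ∑ j ∈ S', ∑ x, if wmin ≤ |w j (blk j x)| then nf x else 0 := by
    rw [Finset.sum_comm, Fintype.sum_prod_type]
    refine Finset.sum_le_sum fun x _ => ?_
    change nf x ≤ _
    by_cases hx : ∃ i, f (x, i) ≠ 0
    · obtain ⟨i, hi⟩ := hx
      obtain ⟨j, hjS, haj, hwj⟩ := hcov x i hi
      have hjS' : j ∈ S' := Finset.mem_filter.mpr ⟨hjS, haj⟩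
      refine le_trans (le_of_eq (if_pos hwj).symm)
        (Finset.single_le_sum (f := fun j => if wmin ≤ |w j (blk j x)| then nf x else 0) (fun j _ => ?_) hjS')
      split_ifs
      · exact hnf0 x
      · exact le_rfl
    · have hz : nf x = 0 := by
        simp only [not_exists, not_not] at hx
        show ∑ i, f (x, i) ^ 2 = 0
        exact Finset.sum_eq_zero fun i _ => by rw [hx i]; ring
      refine hz.trans_le (Finset.sum_nonneg fun j _ => ?_)
      split_ifs
      · exact hnf0 x
      · exact le_rfl
  -- (2) one weighted level: the block step summed over the weighted blocks
  have h2 : ∀ j ∈ S', (∑ x, if wmin ≤ |w j (blk j x)| then nf x else 0) ≤ (wmin ^ 2)⁻¹ * X j + Dv j := by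
    intro j hj
    have hjS : j ∈ S := hS'S hj
    have e : ∑ β ∈ univ.filter (fun β => wmin ≤ |w j β|), ∑ x ∈ univ.filter (fun x => blk j x = β), nf x
        = ∑ x, if wmin ≤ |w j (blk j x)| then nf x else 0 := by
      calc ∑ β ∈ univ.filter (fun β => wmin ≤ |w j β|), ∑ x ∈ univ.filter (fun x => blk j x = β), nf x
          = ∑ β ∈ univ.filter (fun β => wmin ≤ |w j β|), ∑ x, if blk j x = β then nf x else 0 :=
            Finset.sum_congr rfl fun β _ => Finset.sum_filter _ _
        _ = ∑ x, ∑ β ∈ univ.filter (fun β => wmin ≤ |w j β|), if blk j x = β then nf x else 0 :=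
            Finset.sum_comm
        _ = ∑ x, if wmin ≤ |w j (blk j x)| then nf x else 0 := by
            refine Finset.sum_congr rfl fun x _ => ?_
            rw [Finset.sum_ite_eq]
            simp only [Finset.mem_filter, Finset.mem_univ, true_and]
    rw [← e]
    calc ∑ β ∈ univ.filter (fun β => wmin ≤ |w j β|), ∑ x ∈ univ.filter (fun x => blk j x = β), nf x
        ≤ ∑ β ∈ univ.filter (fun β => wmin ≤ |w j β|),
            ((wmin ^ 2)⁻¹ * ∑ i, gMean (blk j) (fun x => w j (blk j x)) (T j) f (β, i) ^ 2 +
              ∑ x ∈ univ.filter (fun x => blk j x = β), ∑ i, gdev (blk j) (T j) (base j) f x i ^ 2) :=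
          Finset.sum_le_sum fun β hβ =>
            block_norm_sq_le (blk j) (w j) (hT j hjS) (base j) f β hwmin (mem_filter.mp hβ).2
      _ ≤ ∑ β, ((wmin ^ 2)⁻¹ * ∑ i, gMean (blk j) (fun x => w j (blk j x)) (T j) f (β, i) ^ 2 +
              ∑ x ∈ univ.filter (fun x => blk j x = β), ∑ i, gdev (blk j) (T j) (base j) f x i ^ 2) :=
          Finset.sum_le_sum_of_subset_of_nonneg (Finset.filter_subset _ _) fun β _ _ =>
            add_nonneg (mul_nonneg (inv_nonneg.mpr (sq_nonneg _)) (Finset.sum_nonneg fun i _ => sq_nonneg _))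
              (Finset.sum_nonneg fun x _ => Finset.sum_nonneg fun i _ => sq_nonneg _)
      _ = (wmin ^ 2)⁻¹ * X j + Dv j := by
          rw [Finset.sum_add_distrib, ← Finset.mul_sum]
          congr 1
          · simp only [hXdef]
            rw [Fintype.sum_prod_type]
          · simp only [hDvdef]
            exact Finset.sum_fiberwise_of_maps_to (s := univ) (t := univ) (g := blk j) (fun x _ => mem_univ _) _
  -- (3) sum over the weighted levels
  have h3 : ∑ p, f p ^ 2 ≤ (wmin ^ 2)⁻¹ * ∑ j ∈ S', X j + ∑ j ∈ S', P j * Y := by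
    refine h1.trans ((Finset.sum_le_sum fun j hj => (h2 j hj).trans
      (add_le_add le_rfl (hP j (hS'S hj)))).trans_eq ?_)
    rw [Finset.sum_add_distrib, Finset.mul_sum]
  -- (4) a_j ≥ a_min on S', everything non-negative elsewhere
  have h4 : ∑ j ∈ S', X j ≤ amin⁻¹ * ∑ j, a j * X j := by
    rw [Finset.mul_sum]
    calc ∑ j ∈ S', X j ≤ ∑ j ∈ S', amin⁻¹ * (a j * X j) := Finset.sum_le_sum fun j hj => by
            have haj : amin ≤ a j := (Finset.mem_filter.mp hj).2
            calc X j = amin⁻¹ * (amin * X j) := by rw [← mul_assoc, inv_mul_cancel₀ hamin.ne', one_mul]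
              _ ≤ amin⁻¹ * (a j * X j) :=
                  mul_le_mul_of_nonneg_left (mul_le_mul_of_nonneg_right haj (hX0 j)) (inv_nonneg.mpr hamin.le)
      _ ≤ ∑ j, amin⁻¹ * (a j * X j) := Finset.sum_le_sum_of_subset_of_nonneg (Finset.subset_univ _)
            fun j _ _ => mul_nonneg (inv_nonneg.mpr hamin.le) (mul_nonneg (ha j) (hX0 j))
  have h5 : ∑ j ∈ S', P j * Y ≤ (∑ j ∈ S, P j) * Y := by
    rw [Finset.sum_mul]
    exact Finset.sum_le_sum_of_subset_of_nonneg hS'S fun j hj _ => hPY j hj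
  calc ∑ p, f p ^ 2 ≤ (wmin ^ 2)⁻¹ * ∑ j ∈ S', X j + ∑ j ∈ S', P j * Y := h3
    _ ≤ (wmin ^ 2)⁻¹ * (amin⁻¹ * ∑ j, a j * X j) + (∑ j ∈ S, P j) * Y :=
        add_le_add (mul_le_mul_of_nonneg_left h4 (inv_nonneg.mpr (sq_nonneg _))) h5
    _ = (amin * wmin ^ 2)⁻¹ * ∑ j, a j * X j + (∑ j ∈ S, P j) * Y := by
        rw [mul_inv, ← mul_assoc, mul_comm (wmin ^ 2)⁻¹]

/-- **The coercivity constant of the level sum** (MODEL bookkeeping): σ = ((a_min·w_min²)⁻¹ + P)⁻¹ with P the sum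
of the Poincaré constants of the covering levels. [folklore] -/
def sigmaL (amin wmin Pc : ℝ) : ℝ := ((amin * wmin ^ 2)⁻¹ + Pc)⁻¹

/-- σ > 0 for a_min, w_min > 0 and P ≥ 0. [folklore] -/
theorem sigmaL_pos {amin wmin Pc : ℝ} (hamin : 0 < amin) (hwmin : 0 < wmin) (hPc : 0 ≤ Pc) :
    0 < sigmaL amin wmin Pc :=
  inv_pos.mpr (add_pos_of_pos_of_nonneg (inv_pos.mpr (mul_pos hamin (pow_pos hwmin 2))) hPc)

/-- The one-level constant of `B9Thm37GlueTorusCovPoinc` is σ with P = D·n/c_min². [folklore] -/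
theorem sigma_eq_sigmaL (a wmin cmin : ℝ) (D n : ℕ) :
    sigma a wmin cmin D n = sigmaL a wmin ((D : ℝ) * n * (cmin ^ 2)⁻¹) := rfl

/-- **COERCIVITY OF Δ_U + Σ_j a_j·G_jᵀG_j ON COVERED SUPPORTS, UNIFORM IN THE TRANSPORT (MODEL of the positivity
of Δ′_a with the level sum (3.16), p. 395, with a constant).**  Levels j ∈ S isometric with deviation bounds
P_j ≥ 0 valid for all fields, all a_j ≥ 0, a_min, w_min > 0: for every field f whose support is covered as in
`norm_sq_le_levels`, σ·Σ_p f(p)² ≤ Σ_p f(p)((Δ_U + Σ_j a_j G_jᵀG_j)f)(p) with σ = `sigmaL a_min w_min (Σ_{j∈S} P_j)`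
— the same σ for every bond transport. [cite: Balaban1985BackgroundPropagators, (3.16) p.393 + (3.23)–(3.24) p.394 + p.395] -/
theorem coercive_levelOp (S : Finset J)
    (hT : ∀ j ∈ S, ∀ x i i', ∑ k, T j x k i * T j x k i' = if i = i' then (1 : ℝ) else 0)
    (ha : ∀ j, 0 ≤ a j) {P : J → ℝ} (hP0 : ∀ j ∈ S, 0 ≤ P j)
    (hP : ∀ j ∈ S, ∀ f : St × Cp → ℝ,
      ∑ x, ∑ i, gdev (blk j) (T j) (base j) f x i ^ 2 ≤ P j * ∑ b, covD src tgt c Rm f b ^ 2)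
    {amin wmin : ℝ} (hamin : 0 < amin) (hwmin : 0 < wmin) (f : St × Cp → ℝ)
    (hcov : ∀ x i, f (x, i) ≠ 0 → ∃ j ∈ S, amin ≤ a j ∧ wmin ≤ |w j (blk j x)|) :
    sigmaL amin wmin (∑ j ∈ S, P j) * ∑ p, f p ^ 2 ≤
      ∑ p, f p * levelOp src tgt c Rm blk (fun j x => w j (blk j x)) T a f p := by
  have hmain := norm_sq_le_levels src tgt c Rm blk w T base a S hT ha P f (fun j hj => hP j hj f) hamin hwmin hcov
  set Y := ∑ b, covD src tgt c Rm f b ^ 2 with hY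
  set AX := ∑ j, a j * ∑ q, gMean (blk j) (fun x => w j (blk j x)) (T j) f q ^ 2 with hAX
  have hq : ∑ p, f p * levelOp src tgt c Rm blk (fun j x => w j (blk j x)) T a f p = Y + AX := by
    rw [qform_levelOp, hY, hAX]
    congr 1
    · exact Finset.sum_congr rfl fun b _ => (sq _).symm
    · exact Finset.sum_congr rfl fun j _ =>
        congrArg (fun t => a j * t) (Finset.sum_congr rfl fun q _ => (sq _).symm)
  rw [hq]
  have hY0 : 0 ≤ Y := Finset.sum_nonneg fun b _ => sq_nonneg _
  have hAX0 : 0 ≤ AX :=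
    Finset.sum_nonneg fun j _ => mul_nonneg (ha j) (Finset.sum_nonneg fun q _ => sq_nonneg _)
  set A := (amin * wmin ^ 2)⁻¹ with hA
  set Pc := ∑ j ∈ S, P j with hPc
  have hA0 : 0 < A := inv_pos.mpr (mul_pos hamin (pow_pos hwmin 2))
  have hPc0 : 0 ≤ Pc := Finset.sum_nonneg hP0
  have h1 : ∑ p, f p ^ 2 ≤ (A + Pc) * (Y + AX) := by
    calc ∑ p, f p ^ 2 ≤ A * AX + Pc * Y := hmain
      _ ≤ (A + Pc) * (Y + AX) := by nlinarith [mul_nonneg hA0.le hY0, mul_nonneg hPc0 hAX0]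
  show (A + Pc)⁻¹ * ∑ p, f p ^ 2 ≤ Y + AX
  calc (A + Pc)⁻¹ * ∑ p, f p ^ 2 ≤ (A + Pc)⁻¹ * ((A + Pc) * (Y + AX)) :=
        mul_le_mul_of_nonneg_left h1 (inv_nonneg.mpr (by linarith))
    _ = Y + AX := by rw [← mul_assoc, inv_mul_cancel₀ (by linarith), one_mul]

/-- **Strict positivity on covered supports from the deviation bounds** (the quantitative form of
`B9Thm37GlueTorusCovLevels.posDef_levelOp_of_cover`: no reproduction hypothesis, the deviation bound replaces it).
[cite: Balaban1985BackgroundPropagators, (3.16) p.393 + (3.23)–(3.24) p.394] -/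
theorem posDef_levelOp_of_dev (S : Finset J)
    (hT : ∀ j ∈ S, ∀ x i i', ∑ k, T j x k i * T j x k i' = if i = i' then (1 : ℝ) else 0)
    (ha : ∀ j, 0 ≤ a j) {P : J → ℝ} (hP0 : ∀ j ∈ S, 0 ≤ P j)
    (hP : ∀ j ∈ S, ∀ f : St × Cp → ℝ,
      ∑ x, ∑ i, gdev (blk j) (T j) (base j) f x i ^ 2 ≤ P j * ∑ b, covD src tgt c Rm f b ^ 2)
    {amin wmin : ℝ} (hamin : 0 < amin) (hwmin : 0 < wmin) (f : St × Cp → ℝ) (hf : f ≠ 0)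
    (hcov : ∀ x i, f (x, i) ≠ 0 → ∃ j ∈ S, amin ≤ a j ∧ wmin ≤ |w j (blk j x)|) :
    0 < ∑ p, f p * levelOp src tgt c Rm blk (fun j x => w j (blk j x)) T a f p := by
  obtain ⟨p₀, hp₀⟩ := Function.ne_iff.mp hf
  have hpos : 0 < ∑ p, f p ^ 2 := lt_of_lt_of_le (by rw [sq]; exact mul_self_pos.mpr hp₀)
    (Finset.single_le_sum (f := fun p => f p ^ 2) (fun p _ => sq_nonneg (f p)) (mem_univ p₀))
  exact lt_of_lt_of_le (mul_pos (sigmaL_pos hamin hwmin (Finset.sum_nonneg hP0)) hpos)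
    (coercive_levelOp src tgt c Rm blk w T base a S hT ha hP0 hP hamin hwmin f hcov)

/-- **Invertibility from the deviation bounds** when the weighted blocks of the levels in S cover all sites — the
reproduction-free form of `B9Thm37GlueTorusCovLevels.isUnit_levelOp`. [cite: Balaban1985BackgroundPropagators, (3.16) p.393 + (3.23)–(3.24) p.394 + p.395] -/
theorem isUnit_levelOp_of_dev (S : Finset J)
    (hT : ∀ j ∈ S, ∀ x i i', ∑ k, T j x k i * T j x k i' = if i = i' then (1 : ℝ) else 0)
    (ha : ∀ j, 0 ≤ a j) {P : J → ℝ} (hP0 : ∀ j ∈ S, 0 ≤ P j)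
    (hP : ∀ j ∈ S, ∀ f : St × Cp → ℝ,
      ∑ x, ∑ i, gdev (blk j) (T j) (base j) f x i ^ 2 ≤ P j * ∑ b, covD src tgt c Rm f b ^ 2)
    {amin wmin : ℝ} (hamin : 0 < amin) (hwmin : 0 < wmin)
    (hcov : ∀ x, ∃ j ∈ S, amin ≤ a j ∧ wmin ≤ |w j (blk j x)|) :
    IsUnit (levelOp src tgt c Rm blk (fun j x => w j (blk j x)) T a) :=
  isUnit_of_posDef fun f hf =>
    posDef_levelOp_of_dev src tgt c Rm blk w T base a S hT ha hP0 hP hamin hwmin f hf fun x _ _ => hcov x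

/-- **ℓ² BOUND OF (Δ_U + Σ_j a_j·G_jᵀG_j)⁻¹, UNIFORM IN THE TRANSPORT**, when the weighted blocks of the levels in S
cover ALL sites: Σ_p ((Δ_U + Σ_j a_j G_jᵀG_j)⁻¹g)(p)² ≤ σ⁻²·Σ_p g(p)². [folklore] -/
theorem inverse_sq_le_levelOp (S : Finset J)
    (hT : ∀ j ∈ S, ∀ x i i', ∑ k, T j x k i * T j x k i' = if i = i' then (1 : ℝ) else 0)
    (ha : ∀ j, 0 ≤ a j) {P : J → ℝ} (hP0 : ∀ j ∈ S, 0 ≤ P j)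
    (hP : ∀ j ∈ S, ∀ f : St × Cp → ℝ,
      ∑ x, ∑ i, gdev (blk j) (T j) (base j) f x i ^ 2 ≤ P j * ∑ b, covD src tgt c Rm f b ^ 2)
    {amin wmin : ℝ} (hamin : 0 < amin) (hwmin : 0 < wmin)
    (hcov : ∀ x, ∃ j ∈ S, amin ≤ a j ∧ wmin ≤ |w j (blk j x)|) (g : St × Cp → ℝ) :
    ∑ p, (Ring.inverse (levelOp src tgt c Rm blk (fun j x => w j (blk j x)) T a) g) p ^ 2 ≤
      (sigmaL amin wmin (∑ j ∈ S, P j) ^ 2)⁻¹ * ∑ p, g p ^ 2 :=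
  inverse_sq_le_of_coercive _ (sigmaL_pos hamin hwmin (Finset.sum_nonneg hP0))
    (fun f => coercive_levelOp src tgt c Rm blk w T base a S hT ha hP0 hP hamin hwmin f fun x _ _ => hcov x) g

/-- **ℓ² BOUND OF THE DIRICHLET INVERSE G′ = `dirInv (Δ_U + Σ_j a_j·G_jᵀG_j) Ω₀`, UNIFORM IN THE TRANSPORT**, when
the weighted blocks of the levels in S cover Ω₀ = {χ = 1} only (χ {0,1}-valued):
Σ_p (G′g)(p)² ≤ σ⁻²·Σ_p g(p)² for every g (G′ is the genuine inverse of Ω₀(Δ_U + Q\*aQ)Ω₀ on Ω₀,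
`B9Thm37GlueTorusCovLevels.levelDir_right`). [cite: Balaban1985BackgroundPropagators, (3.16) p.393 + p.394 + p.395] -/
theorem levelDir_sq_le (S : Finset J)
    (hT : ∀ j ∈ S, ∀ x i i', ∑ k, T j x k i * T j x k i' = if i = i' then (1 : ℝ) else 0)
    (ha : ∀ j, 0 ≤ a j) {P : J → ℝ} (hP0 : ∀ j ∈ S, 0 ≤ P j)
    (hP : ∀ j ∈ S, ∀ f : St × Cp → ℝ,
      ∑ x, ∑ i, gdev (blk j) (T j) (base j) f x i ^ 2 ≤ P j * ∑ b, covD src tgt c Rm f b ^ 2)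
    {amin wmin : ℝ} (hamin : 0 < amin) (hwmin : 0 < wmin) {χ : St × Cp → ℝ} (hχ : ∀ p, χ p = 0 ∨ χ p = 1)
    (hcov : ∀ x i, χ (x, i) = 1 → ∃ j ∈ S, amin ≤ a j ∧ wmin ≤ |w j (blk j x)|) (g : St × Cp → ℝ) :
    ∑ p, (dirInv (levelOp src tgt c Rm blk (fun j x => w j (blk j x)) T a) χ g) p ^ 2 ≤
      (sigmaL amin wmin (∑ j ∈ S, P j) ^ 2)⁻¹ * ∑ p, g p ^ 2 :=
  dirInv_sq_le_of_coercive _ hχ (qform_levelOp_nonneg src tgt c Rm blk _ T ha)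
    (sigmaL_pos hamin hwmin (Finset.sum_nonneg hP0))
    (fun f hf => coercive_levelOp src tgt c Rm blk w T base a S hT ha hP0 hP hamin hwmin f
      fun x i hxi => hcov x i (hf (x, i) hxi)) g

end Assembly

/-! ## §5  Dischargers: the three-level family of `B9Thm37GlueTorusCovLevels` and the one comb level -/

section ThreeLevels

variable {St Bd B₁ B Cp : Type} [Fintype St] [DecidableEq St] [Fintype Bd] [Fintype B₁] [DecidableEq B₁]
  [Fintype Cp] [DecidableEq Cp] {src tgt : Bd → St} (K₁ : Comb src tgt B₁) (K : Comb src tgt B)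
  (Rm : Bd → Cp → Cp → ℝ)

omit [Fintype St] [DecidableEq St] [Fintype Bd] [Fintype B₁] [DecidableEq B₁] in
/-- The identity level (Q₀ = 1) has deviation 0. [folklore] -/
theorem gdev_lvl_zero (f : St × Cp → ℝ) (x : St) (i : Cp) :
    gdev (lvlBlk K₁ K 0) (lvlTr K₁ K Rm 0) (fun y => y) f x i = 0 := by
  show (∑ k, (if i = k then (1 : ℝ) else 0) * f (x, k)) - f (x, i) = 0
  rw [one_reproduces, sub_self]

omit [Fintype St] [DecidableEq St] [Fintype Bd] [Fintype B₁] [DecidableEq B₁] in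
/-- The comb level of the three-level family has the comb deviation of `B9Thm37GlueTorusCovPoinc`. [folklore] -/
theorem gdev_lvl_one (f : St × Cp → ℝ) (x : St) (i : Cp) :
    gdev (lvlBlk K₁ K 1) (lvlTr K₁ K Rm 1) (fun y => y) f x i = dev K₁ Rm f x i := rfl

/-- MODEL bookkeeping: the Poincaré constants of the three levels — 0 for the identity level, D·n/c_min² for the
comb level (depth ≤ D, blocks of ≤ n sites, |c(b)| ≥ c_min), and 0 as a placeholder for the composite level 2,
which is NOT a Poincaré level here. [folklore] -/
def lvlP (cmin : ℝ) (D n : ℕ) : Fin 3 → ℝ := fun l => if l = 1 then (D : ℝ) * n * (cmin ^ 2)⁻¹ else 0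

/-- The identity level has constant 0. [folklore] -/
theorem lvlP_zero (cmin : ℝ) (D n : ℕ) : lvlP cmin D n 0 = 0 := if_neg (by decide)

/-- The comb level has constant D·n/c_min². [folklore] -/
theorem lvlP_one (cmin : ℝ) (D n : ℕ) : lvlP cmin D n 1 = (D : ℝ) * n * (cmin ^ 2)⁻¹ := if_pos rfl

/-- The level constants are ≥ 0. [folklore] -/
theorem lvlP_nonneg (cmin : ℝ) (D n : ℕ) (l : Fin 3) : 0 ≤ lvlP cmin D n l := by
  unfold lvlP
  split_ifs
  · exact mul_nonneg (mul_nonneg (Nat.cast_nonneg _) (Nat.cast_nonneg _)) (inv_nonneg.mpr (sq_nonneg _))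
  · exact le_rfl

/-- Over the Poincaré levels {0, 1} the constants sum to D·n/c_min². [folklore] -/
theorem sum_lvlP (cmin : ℝ) (D n : ℕ) :
    ∑ l ∈ ({0, 1} : Finset (Fin 3)), lvlP cmin D n l = (D : ℝ) * n * (cmin ^ 2)⁻¹ := by
  rw [Finset.sum_pair (show (0 : Fin 3) ≠ 1 by decide), lvlP_zero, lvlP_one, zero_add]

/-- Hence the level-sum constant of the three-level family is the one-level constant σ of
`B9Thm37GlueTorusCovPoinc` with a replaced by a_min. [folklore] -/
theorem sigmaL_lvlP (amin wmin cmin : ℝ) (D n : ℕ) :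
    sigmaL amin wmin (∑ l ∈ ({0, 1} : Finset (Fin 3)), lvlP cmin D n l) = sigma amin wmin cmin D n := by
  rw [sum_lvlP]
  rfl

/-- The deviation bounds of the two Poincaré levels of the three-level family (identity: 0; comb: `sum_dev_sq_le`).
[folklore] -/
theorem lvl_dev_sq_le (hRm : ∀ b i j, ∑ k, Rm b k i * Rm b k j = if i = j then (1 : ℝ) else 0)
    {c : Bd → ℝ} {cmin : ℝ} (hcmin : 0 < cmin) (hc : ∀ b, cmin ≤ |c b|) {D : ℕ} (hD : ∀ x, K₁.depth x ≤ D)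
    {n : ℕ} (hn : ∀ β, (univ.filter fun x => K₁.blk x = β).card ≤ n) :
    ∀ l ∈ ({0, 1} : Finset (Fin 3)), ∀ f : St × Cp → ℝ,
      ∑ x, ∑ i, gdev (lvlBlk K₁ K l) (lvlTr K₁ K Rm l) (fun y => y) f x i ^ 2 ≤
        lvlP cmin D n l * ∑ b, covD src tgt c Rm f b ^ 2 := by
  intro l hl f
  simp only [Finset.mem_insert, Finset.mem_singleton] at hl
  rcases hl with rfl | rfl
  · rw [lvlP_zero, zero_mul]
    simp only [gdev_lvl_zero]
    simp
  · rw [lvlP_one]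
    simp only [gdev_lvl_one]
    exact sum_dev_sq_le K₁ c Rm hRm hcmin hc hD hn f

/-- **COERCIVITY OF THE THREE-LEVEL OPERATOR Δ_U + a₀·M_{W₀}ᵀM_{W₀} + a₁·Q₁ᵀQ₁ + a₂·(Q₂Q₁)ᵀ(Q₂Q₁) ON COVERED SUPPORTS,
UNIFORM IN THE TRANSPORT** (block weights W_l = w_l ∘ lvlBlk_l, i.e. w₀(x), w₁(the K₁-base point of x), w₂(the
K-base point of that); all a_l ≥ 0).  If every site x of the support of f has a_0 ≥ a_min and |w₀(x)| ≥ w_min, or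
a_1 ≥ a_min and |w₁(K₁-base of x)| ≥ w_min (level 2 is not used), then
σ·Σ_p f(p)² ≤ Σ_p f(p)(… f)(p) with σ = `sigma a_min w_min c_min D n` of `B9Thm37GlueTorusCovPoinc` (K₁ of depth ≤ D
with blocks of ≤ n sites, |c(b)| ≥ c_min > 0, hRm). [cite: Balaban1985BackgroundPropagators, (3.16) p.393 + (3.23)–(3.24) p.394 + p.395] -/
theorem coercive_threeLevelOp (hRm : ∀ b i j, ∑ k, Rm b k i * Rm b k j = if i = j then (1 : ℝ) else 0)
    {c : Bd → ℝ} {cmin : ℝ} (hcmin : 0 < cmin) (hc : ∀ b, cmin ≤ |c b|) {D : ℕ} (hD : ∀ x, K₁.depth x ≤ D)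
    {n : ℕ} (hn : ∀ β, (univ.filter fun x => K₁.blk x = β).card ≤ n) (w : Fin 3 → St → ℝ) {a : Fin 3 → ℝ}
    (ha : ∀ l, 0 ≤ a l) {amin wmin : ℝ} (hamin : 0 < amin) (hwmin : 0 < wmin) (f : St × Cp → ℝ)
    (hcov : ∀ x i, f (x, i) ≠ 0 →
      ∃ l ∈ ({0, 1} : Finset (Fin 3)), amin ≤ a l ∧ wmin ≤ |w l (lvlBlk K₁ K l x)|) :
    sigma amin wmin cmin D n * ∑ p, f p ^ 2 ≤
      ∑ p, f p * threeLevelOp K₁ K Rm c (fun l x => w l (lvlBlk K₁ K l x)) a f p := by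
  rw [← sigmaL_lvlP amin wmin cmin D n]
  exact coercive_levelOp src tgt c Rm (lvlBlk K₁ K) w (lvlTr K₁ K Rm) (fun _ y => y) a {0, 1}
    (fun l _ => lvlTr_orth K₁ K Rm hRm l) ha (fun l _ => lvlP_nonneg cmin D n l)
    (lvl_dev_sq_le K₁ K Rm hRm hcmin hc hD hn) hamin hwmin f hcov

/-- **ℓ² bound of the inverse of the three-level operator, uniform in the transport**, when levels 0 and 1 cover all
sites: Σ_p ((…)⁻¹g)(p)² ≤ σ⁻²·Σ_p g(p)², σ = `sigma a_min w_min c_min D n`. [folklore] -/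
theorem inverse_sq_le_threeLevelOp (hRm : ∀ b i j, ∑ k, Rm b k i * Rm b k j = if i = j then (1 : ℝ) else 0)
    {c : Bd → ℝ} {cmin : ℝ} (hcmin : 0 < cmin) (hc : ∀ b, cmin ≤ |c b|) {D : ℕ} (hD : ∀ x, K₁.depth x ≤ D)
    {n : ℕ} (hn : ∀ β, (univ.filter fun x => K₁.blk x = β).card ≤ n) (w : Fin 3 → St → ℝ) {a : Fin 3 → ℝ}
    (ha : ∀ l, 0 ≤ a l) {amin wmin : ℝ} (hamin : 0 < amin) (hwmin : 0 < wmin)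
    (hcov : ∀ x, ∃ l ∈ ({0, 1} : Finset (Fin 3)), amin ≤ a l ∧ wmin ≤ |w l (lvlBlk K₁ K l x)|)
    (g : St × Cp → ℝ) :
    ∑ p, (Ring.inverse (threeLevelOp K₁ K Rm c (fun l x => w l (lvlBlk K₁ K l x)) a) g) p ^ 2 ≤
      (sigma amin wmin cmin D n ^ 2)⁻¹ * ∑ p, g p ^ 2 := by
  rw [← sigmaL_lvlP amin wmin cmin D n]
  exact inverse_sq_le_levelOp src tgt c Rm (lvlBlk K₁ K) w (lvlTr K₁ K Rm) (fun _ y => y) a {0, 1}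
    (fun l _ => lvlTr_orth K₁ K Rm hRm l) ha (fun l _ => lvlP_nonneg cmin D n l)
    (lvl_dev_sq_le K₁ K Rm hRm hcmin hc hD hn) hamin hwmin hcov g

/-- **ℓ² bound of the DIRICHLET INVERSE of the three-level operator on Ω₀ = {χ = 1}, uniform in the transport**,
when levels 0 and 1 cover Ω₀: Σ_p (G′g)(p)² ≤ σ⁻²·Σ_p g(p)², σ = `sigma a_min w_min c_min D n`.
[cite: Balaban1985BackgroundPropagators, (3.16) p.393 + p.394 + p.395] -/
theorem threeLevelDir_sq_le (hRm : ∀ b i j, ∑ k, Rm b k i * Rm b k j = if i = j then (1 : ℝ) else 0)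
    {c : Bd → ℝ} {cmin : ℝ} (hcmin : 0 < cmin) (hc : ∀ b, cmin ≤ |c b|) {D : ℕ} (hD : ∀ x, K₁.depth x ≤ D)
    {n : ℕ} (hn : ∀ β, (univ.filter fun x => K₁.blk x = β).card ≤ n) (w : Fin 3 → St → ℝ) {a : Fin 3 → ℝ}
    (ha : ∀ l, 0 ≤ a l) {amin wmin : ℝ} (hamin : 0 < amin) (hwmin : 0 < wmin) {χ : St × Cp → ℝ}
    (hχ : ∀ p, χ p = 0 ∨ χ p = 1)
    (hcov : ∀ x i, χ (x, i) = 1 → ∃ l ∈ ({0, 1} : Finset (Fin 3)), amin ≤ a l ∧ wmin ≤ |w l (lvlBlk K₁ K l x)|)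
    (g : St × Cp → ℝ) :
    ∑ p, (dirInv (threeLevelOp K₁ K Rm c (fun l x => w l (lvlBlk K₁ K l x)) a) χ g) p ^ 2 ≤
      (sigma amin wmin cmin D n ^ 2)⁻¹ * ∑ p, g p ^ 2 := by
  rw [← sigmaL_lvlP amin wmin cmin D n]
  exact levelDir_sq_le src tgt c Rm (lvlBlk K₁ K) w (lvlTr K₁ K Rm) (fun _ y => y) a {0, 1}
    (fun l _ => lvlTr_orth K₁ K Rm hRm l) ha (fun l _ => lvlP_nonneg cmin D n l)
    (lvl_dev_sq_le K₁ K Rm hRm hcmin hc hD hn) hamin hwmin hχ hcov g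

end ThreeLevels

section OneComb

variable {St Bd B Cp : Type} [Fintype St] [DecidableEq St] [Fintype Bd] [Fintype B] [DecidableEq B] [Fintype Cp]
  [DecidableEq Cp] {src tgt : Bd → St} (K : Comb src tgt B) (c : Bd → ℝ) (w : B → ℝ) (Rm : Bd → Cp → Cp → ℝ)

omit [Fintype B] in
/-- The one-member level family over the comb K is the one-step operator Δ_U + a·Q_UᵀQ_U of `B9Thm37GlueTorusCov`
(`levelOp_const`, `covLapCov_eq_gLapCov`). [folklore] -/
theorem levelOp_comb_eq (a : ℝ) :
    levelOp src tgt c Rm (fun _ : Unit => K.blk) (fun _ x => w (K.blk x)) (fun _ => K.tr Rm) (fun _ => a) =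
      covLapCov K c w Rm a := by
  rw [levelOp_const, covLapCov_eq_gLapCov]

/-- **COERCIVITY OF Δ_U + a·Q_UᵀQ_U ON COVERED SUPPORTS** — `B9Thm37GlueTorusCovPoinc.coercive_covLapCov` with the
lower bound |w(β)| ≥ w_min required only on the blocks meeting the support of f (the other block weights are
arbitrary, e.g. 0): σ·Σ_p f(p)² ≤ Σ_p f(p)((Δ_U + a·Q_UᵀQ_U)f)(p), σ = `sigma a w_min c_min D n`. [cite: Balaban1985BackgroundPropagators, p.395 + (3.23)–(3.24) p.394 + (3.19) p.393] -/
theorem coercive_covLapCov_of_cover (hRm : ∀ b i j, ∑ k, Rm b k i * Rm b k j = if i = j then (1 : ℝ) else 0)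
    {cmin : ℝ} (hcmin : 0 < cmin) (hc : ∀ b, cmin ≤ |c b|) {wmin : ℝ} (hwmin : 0 < wmin)
    {D : ℕ} (hD : ∀ x, K.depth x ≤ D) {n : ℕ} (hn : ∀ β, (univ.filter fun x => K.blk x = β).card ≤ n)
    {a : ℝ} (ha : 0 < a) (f : St × Cp → ℝ) (hcov : ∀ x i, f (x, i) ≠ 0 → wmin ≤ |w (K.blk x)|) :
    sigma a wmin cmin D n * ∑ p, f p ^ 2 ≤ ∑ p, f p * covLapCov K c w Rm a f p := by
  rw [← levelOp_comb_eq, sigma_eq_sigmaL]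
  have h := coercive_levelOp src tgt c Rm (fun _ : Unit => K.blk) (fun _ => w) (fun _ => K.tr Rm)
    (fun _ => K.base) (fun _ => a) Finset.univ (fun _ _ => K.tr_orth Rm hRm) (fun _ => ha.le)
    (P := fun _ => (D : ℝ) * n * (cmin ^ 2)⁻¹)
    (fun _ _ => mul_nonneg (mul_nonneg (Nat.cast_nonneg _) (Nat.cast_nonneg _)) (inv_nonneg.mpr (sq_nonneg _)))
    (fun _ _ f => sum_dev_sq_le K c Rm hRm hcmin hc hD hn f) ha hwmin f
    (fun x i hxi => ⟨(), Finset.mem_univ _, le_rfl, hcov x i hxi⟩)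
  rwa [Finset.univ_unique, Finset.sum_singleton] at h

/-- **ℓ² BOUND OF THE DIRICHLET INVERSE G′ = `dirInv (Δ_U + a·Q_UᵀQ_U) Ω₀`, UNIFORM IN THE TRANSPORT** — the
Dirichlet companion of `B9Thm37GlueTorusCovPoinc.inverse_sq_le`: χ {0,1}-valued, every block meeting
Ω₀ = {χ = 1} weighted with |w(β)| ≥ w_min > 0, a > 0 ⟹ Σ_p (G′g)(p)² ≤ σ⁻²·Σ_p g(p)², σ = `sigma a w_min c_min D n`.
[cite: Balaban1985BackgroundPropagators, p.394 + p.395 + (3.23)–(3.24) p.394] -/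
theorem dirInv_covLapCov_sq_le (hRm : ∀ b i j, ∑ k, Rm b k i * Rm b k j = if i = j then (1 : ℝ) else 0)
    {cmin : ℝ} (hcmin : 0 < cmin) (hc : ∀ b, cmin ≤ |c b|) {wmin : ℝ} (hwmin : 0 < wmin)
    {D : ℕ} (hD : ∀ x, K.depth x ≤ D) {n : ℕ} (hn : ∀ β, (univ.filter fun x => K.blk x = β).card ≤ n)
    {a : ℝ} (ha : 0 < a) {χ : St × Cp → ℝ} (hχ : ∀ p, χ p = 0 ∨ χ p = 1)
    (hcov : ∀ x i, χ (x, i) = 1 → wmin ≤ |w (K.blk x)|) (g : St × Cp → ℝ) :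
    ∑ p, (dirInv (covLapCov K c w Rm a) χ g) p ^ 2 ≤ (sigma a wmin cmin D n ^ 2)⁻¹ * ∑ p, g p ^ 2 :=
  dirInv_sq_le_of_coercive _ hχ
    (fun f => by
      rw [qform_covLapCov]
      exact add_nonneg (Finset.sum_nonneg fun b _ => mul_self_nonneg _)
        (mul_nonneg ha.le (Finset.sum_nonneg fun q _ => mul_self_nonneg _)))
    (sigma_pos ha hwmin cmin D n)
    (fun f hf => coercive_covLapCov_of_cover K c w Rm hRm hcmin hc hwmin hD hn ha f
      fun x i hxi => hcov x i (hf (x, i) hxi)) g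

end OneComb

/-! ## §6  The torus: σ(d, M₀, a_min, w_min, c_min), uniform in the volume, the coarse side and the transport -/

section Torus

variable {d : ℕ} {N : Fin d → ℕ} [∀ i, NeZero (N i)] [NeZero d]

/-- **COERCIVITY OF THE THREE-LEVEL OPERATOR ON THE TORUS, UNIFORM IN THE VOLUME AND IN THE TRANSPORT**: cube combs of
sides M₀ (levels 1) and M (level 2), 1 ≤ M₀, M₀ ∣ N_i, 1 ≤ M, M ∣ N_i; isometric Rm; |c(b)| ≥ c_min > 0; block
weights w_l at the representative corner sites; all a_l ≥ 0; support of f covered by level 0 or level 1 with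
a_l ≥ a_min, |w_l| ≥ w_min ⟹ σ(d, M₀, a_min, w_min, c_min)·Σ_p f(p)² ≤ Σ_p f(p)(… f)(p) — σ = `sigmaTorus` of
`B9Thm37GlueTorusCovPoinc`, independent of N, M and U. [cite: Balaban1985BackgroundPropagators, (3.16) p.393 + (3.23)–(3.24) p.394 + p.395] -/
theorem coercive_threeLevelOp_torus {Cp : Type} [Fintype Cp] [DecidableEq Cp] {M₀ M : ℕ} (hM₀ : 1 ≤ M₀)
    (hdiv₀ : ∀ i, M₀ ∣ N i) (hM : 1 ≤ M) (hdiv : ∀ i, M ∣ N i) {Rm : UT N × Fin d → Cp → Cp → ℝ}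
    (hRm : ∀ b i j, ∑ k, Rm b k i * Rm b k j = if i = j then (1 : ℝ) else 0) {c : UT N × Fin d → ℝ}
    {cmin : ℝ} (hcmin : 0 < cmin) (hc : ∀ b, cmin ≤ |c b|) (w : Fin 3 → UT N → ℝ) {a : Fin 3 → ℝ}
    (ha : ∀ l, 0 ≤ a l) {amin wmin : ℝ} (hamin : 0 < amin) (hwmin : 0 < wmin) (f : UT N × Cp → ℝ)
    (hcov : ∀ x i, f (x, i) ≠ 0 → ∃ l ∈ ({0, 1} : Finset (Fin 3)), amin ≤ a l ∧
      wmin ≤ |w l (lvlBlk (torusComb hM₀ hdiv₀) (torusComb hM hdiv) l x)|) :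
    sigmaTorus d M₀ amin wmin cmin * ∑ p, f p ^ 2 ≤
      ∑ p, f p * threeLevelOp (torusComb hM₀ hdiv₀) (torusComb hM hdiv) Rm c
        (fun l x => w l (lvlBlk (torusComb hM₀ hdiv₀) (torusComb hM hdiv) l x)) a f p :=
  coercive_threeLevelOp (torusComb hM₀ hdiv₀) (torusComb hM hdiv) Rm hRm hcmin hc (fun x => tdepth_le hM₀ x)
    (fun z => card_block_le hM₀ hdiv₀ z) w ha hamin hwmin f hcov

/-- **ℓ² bound of the inverse of the three-level operator on the torus, uniform in the volume and the transport**,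
levels 0 and 1 covering all sites: Σ_p ((…)⁻¹g)(p)² ≤ σ(d, M₀, a_min, w_min, c_min)⁻²·Σ_p g(p)². [folklore] -/
theorem inverse_sq_le_threeLevelOp_torus {Cp : Type} [Fintype Cp] [DecidableEq Cp] {M₀ M : ℕ} (hM₀ : 1 ≤ M₀)
    (hdiv₀ : ∀ i, M₀ ∣ N i) (hM : 1 ≤ M) (hdiv : ∀ i, M ∣ N i) {Rm : UT N × Fin d → Cp → Cp → ℝ}
    (hRm : ∀ b i j, ∑ k, Rm b k i * Rm b k j = if i = j then (1 : ℝ) else 0) {c : UT N × Fin d → ℝ}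
    {cmin : ℝ} (hcmin : 0 < cmin) (hc : ∀ b, cmin ≤ |c b|) (w : Fin 3 → UT N → ℝ) {a : Fin 3 → ℝ}
    (ha : ∀ l, 0 ≤ a l) {amin wmin : ℝ} (hamin : 0 < amin) (hwmin : 0 < wmin)
    (hcov : ∀ x, ∃ l ∈ ({0, 1} : Finset (Fin 3)), amin ≤ a l ∧
      wmin ≤ |w l (lvlBlk (torusComb hM₀ hdiv₀) (torusComb hM hdiv) l x)|) (g : UT N × Cp → ℝ) :
    ∑ p, (Ring.inverse (threeLevelOp (torusComb hM₀ hdiv₀) (torusComb hM hdiv) Rm c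
        (fun l x => w l (lvlBlk (torusComb hM₀ hdiv₀) (torusComb hM hdiv) l x)) a) g) p ^ 2 ≤
      (sigmaTorus d M₀ amin wmin cmin ^ 2)⁻¹ * ∑ p, g p ^ 2 :=
  inverse_sq_le_threeLevelOp (torusComb hM₀ hdiv₀) (torusComb hM hdiv) Rm hRm hcmin hc
    (fun x => tdepth_le hM₀ x) (fun z => card_block_le hM₀ hdiv₀ z) w ha hamin hwmin hcov g

/-- **ℓ² bound of the DIRICHLET INVERSE of the three-level operator on a domain Ω₀ of the torus, uniform in the
volume and the transport**, levels 0 and 1 covering Ω₀ = {χ = 1}: Σ_p (G′g)(p)² ≤ σ(d, M₀, a_min, w_min,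
c_min)⁻²·Σ_p g(p)². [cite: Balaban1985BackgroundPropagators, (3.16) p.393 + p.394 + p.395] -/
theorem threeLevelDir_sq_le_torus {Cp : Type} [Fintype Cp] [DecidableEq Cp] {M₀ M : ℕ} (hM₀ : 1 ≤ M₀)
    (hdiv₀ : ∀ i, M₀ ∣ N i) (hM : 1 ≤ M) (hdiv : ∀ i, M ∣ N i) {Rm : UT N × Fin d → Cp → Cp → ℝ}
    (hRm : ∀ b i j, ∑ k, Rm b k i * Rm b k j = if i = j then (1 : ℝ) else 0) {c : UT N × Fin d → ℝ}
    {cmin : ℝ} (hcmin : 0 < cmin) (hc : ∀ b, cmin ≤ |c b|) (w : Fin 3 → UT N → ℝ) {a : Fin 3 → ℝ}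
    (ha : ∀ l, 0 ≤ a l) {amin wmin : ℝ} (hamin : 0 < amin) (hwmin : 0 < wmin) {χ : UT N × Cp → ℝ}
    (hχ : ∀ p, χ p = 0 ∨ χ p = 1)
    (hcov : ∀ x i, χ (x, i) = 1 → ∃ l ∈ ({0, 1} : Finset (Fin 3)), amin ≤ a l ∧
      wmin ≤ |w l (lvlBlk (torusComb hM₀ hdiv₀) (torusComb hM hdiv) l x)|) (g : UT N × Cp → ℝ) :
    ∑ p, (dirInv (threeLevelOp (torusComb hM₀ hdiv₀) (torusComb hM hdiv) Rm c
        (fun l x => w l (lvlBlk (torusComb hM₀ hdiv₀) (torusComb hM hdiv) l x)) a) χ g) p ^ 2 ≤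
      (sigmaTorus d M₀ amin wmin cmin ^ 2)⁻¹ * ∑ p, g p ^ 2 :=
  threeLevelDir_sq_le (torusComb hM₀ hdiv₀) (torusComb hM hdiv) Rm hRm hcmin hc (fun x => tdepth_le hM₀ x)
    (fun z => card_block_le hM₀ hdiv₀ z) w ha hamin hwmin hχ hcov g

/-- **ℓ² bound of the Dirichlet inverse of the ONE-STEP operator Δ_U + a·Q_UᵀQ_U on a domain Ω₀ of the torus,
uniform in the volume and the transport** (cube comb of side M₀; every M₀-block meeting Ω₀ weighted ≥ w_min; a > 0):
Σ_p (G′g)(p)² ≤ σ(d, M₀, a, w_min, c_min)⁻²·Σ_p g(p)². [cite: Balaban1985BackgroundPropagators, p.394 + p.395 + (3.23)–(3.24) p.394] -/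
theorem dirInv_covLapCov_sq_le_torus {Cp : Type} [Fintype Cp] [DecidableEq Cp] {M₀ : ℕ} (hM₀ : 1 ≤ M₀)
    (hdiv₀ : ∀ i, M₀ ∣ N i) {Rm : UT N × Fin d → Cp → Cp → ℝ}
    (hRm : ∀ b i j, ∑ k, Rm b k i * Rm b k j = if i = j then (1 : ℝ) else 0) (c : UT N × Fin d → ℝ)
    {cmin : ℝ} (hcmin : 0 < cmin) (hc : ∀ b, cmin ≤ |c b|) (w : Ctr N M₀ → ℝ) {wmin : ℝ} (hwmin : 0 < wmin)
    {a : ℝ} (ha : 0 < a) {χ : UT N × Cp → ℝ} (hχ : ∀ p, χ p = 0 ∨ χ p = 1)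
    (hcov : ∀ x i, χ (x, i) = 1 → wmin ≤ |w (tblk hM₀ hdiv₀ x)|) (g : UT N × Cp → ℝ) :
    ∑ p, (dirInv (covLapCov (torusComb hM₀ hdiv₀) c w Rm a) χ g) p ^ 2 ≤
      (sigmaTorus d M₀ a wmin cmin ^ 2)⁻¹ * ∑ p, g p ^ 2 :=
  dirInv_covLapCov_sq_le (torusComb hM₀ hdiv₀) c w Rm hRm hcmin hc hwmin (fun x => tdepth_le hM₀ x)
    (fun z => card_block_le hM₀ hdiv₀ z) ha hχ hcov g

end Torus

end

end Literature.MathematicalPhysics.QuantumFieldTheory.Balaban1983to89.B9Thm37GlueTorusCovLevelsPoinc
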